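import Literature.Barriers.NavierStokesRegularity.ExactModeLineDecayLaws
import Mathlib.Analysis.SpecialFunctions.Integrals.Basic
import HarnessLib

/-!
# Barrier: TIME-AVERAGED (Cesàro) spectral information does not control the sup-in-time Sobolev norms
# of an individual Navier–Stokes solution

Barrier catalogue entry for `NavierStokesRegularity` (D-0021), METHOD LEVEL, everything PROVED (zero fact
debt). Cell `ns-claims` (D-0090), technique row T5 «statistical / invariant-measure / time-averaged-spectrum
arguments» (its barrier cell was empty); salvage seat ns-claims-salvage-p5 g3. Companion of
`ExactModeLineDecayLaws` (refuter-2 g4; the same exact Stokes-mode line, there read through autonomous decay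
LAWS, here through TIME AVERAGES).

THE SCHEME. A statistical-turbulence route to regularity defines, for a (weak) solution `u` on `𝕋³`, the
TIME-AVERAGED energy spectrum `Φ(k) = lim_{T→∞} (1/T)∫₀ᵀ ½|û(k,t)|² dt` (or an invariant / renormalisation
measure built from it), argues a universal law for `Φ` (a K41 power law, support/scaling rigidity), and then
reads off `sup_{t≥0} ‖u(t)‖_{H^s} ≤ C_s` «by Parseval, \overline{‖u‖²_{H^s}} = Σ(1+|k|²)^sΦ(k), … and standard
estimates» — typed device of record (when adjudicated): C138 `LiuYong2026`, Prop 4.4 p.18–19 / Lemma H.1 p.57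
(locators only; nothing about that text is asserted here) [cite: LiuYong2026, Prop 4.4 p.18–19; App. H Lemma H.1 p.57].

WHAT IS PROVED HERE (the method-level negative). On the exact Stokes-mode line
`u_a(t) = a e^{−4π²νl²t} sin(2πl x₂) e₁` (global classical zero-mean solutions of the unforced equations for
EVERY amplitude `a` and viscosity `ν`; tree `Torus.isClassicalNSSolutionOn_shearWave`, packaged as
`ExactModeLine.line` [cite: Pizzocchero2021, §6 (6.3), (6.6)–(6.7)]):
* (`private`) `integral_exp_neg_mul_le` — `∫₀ᵀ e^{−μt}dt ≤ 1/μ` (`μ > 0`, any `T`);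
* `cesaroMean_N_line_le` — for every degree-`q` homogeneous functional `N ≥ 0` on the mode,
  `(1/T)∫₀ᵀ N(u_a(t))dt ≤ a^q N(wave)/(q·rate·T)`; hence `tendsto_cesaroMean_N_line` — the Cesàro mean of
  `N(u_a(·))` tends to `0` as `T → ∞`, for EVERY amplitude `a` (all time-averaged spectral statistics of the
  line VANISH, whatever the datum's size);
* `N_line_zero` — `N(u_a(0)) = a^q N(wave)`: the sup-in-time value is as large as one pleases;
* (`private`) `no_bound_of_unbounded_family` — the abstract no-go: a statistic that is constant on a family with unbounded
  size cannot bound the size through ANY function;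
* `no_sup_bound_on_line_family` / `hsSq_no_sup_bound_from_cesaro_decay` — for the Fourier-side Sobolev
  functionals `N_s = Σ|m|^{2s}|ŵ(m)|²` (`ExactModeLine.hsSq`, every real `s`, every `ν > 0`): there is NO
  constant `C` such that every classical zero-mean solution on `𝕋³ × [0,∞)` whose Cesàro means
  `(1/T)∫₀ᵀ N_s(u(t))dt → 0` (the strongest possible time-averaged spectral decay hypothesis — it implies
  `Φ ≡ 0`, hence every power-law or support hypothesis on `Φ`) has `N_s(u(t)) ≤ C` for all `t ≥ 0`; more
  generally no hypothesis `P` satisfied along the whole amplitude line can do it;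
* `CesaroSpectrumNoSupControl` (structured barrier block) and `cesaroSpectrumNoSupControl_holds`.

WHAT THIS IS NOT: not a claim about NS regularity or blow-up; not a claim about any author beyond the typed
locator.
-/

noncomputable section

open Set Filter Topology MeasureTheory intervalIntegral UnitAddTorus

namespace Literature.Barriers.NavierStokesRegularity

namespace CesaroSpectrum

open ExactModeLine Literature.Analysis.FunctionSpaces Literature.Analysis.FunctionSpaces.Torus
  Literature.Analysis.FluidPDE

/-- The Cesàro (time) mean of `g` over `[0,T]`: `(1/T)∫₀ᵀ g`. [folklore] -/
def cesaroMean (g : ℝ → ℝ) (T : ℝ) : ℝ :=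
  T⁻¹ * ∫ t in (0 : ℝ)..T, g t

/-! ### Elementary integral bound -/

/-- `∫₀ᵀ e^{−μt} dt = (1 − e^{−μT})/μ ≤ 1/μ` for `μ > 0` (any real `T`). [folklore] -/
private theorem integral_exp_neg_mul_le {μ : ℝ} (hμ : 0 < μ) (T : ℝ) :
    ∫ t in (0 : ℝ)..T, Real.exp (-μ * t) ≤ 1 / μ := by
  have hderiv : ∀ t ∈ uIcc (0 : ℝ) T,
      HasDerivAt (fun t => -(1 / μ) * Real.exp (-μ * t)) (Real.exp (-μ * t)) t := by
    intro t _
    have h1 : HasDerivAt (fun t => -μ * t) (-μ) t := by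
      simpa using (hasDerivAt_id t).const_mul (-μ)
    have h2 := h1.exp.const_mul (-(1 / μ))
    have hμ0 : μ ≠ 0 := hμ.ne'
    have h3 : -(1 / μ) * (Real.exp (-μ * t) * -μ) = Real.exp (-μ * t) := by field_simp
    rw [h3] at h2
    exact h2
  have hint : IntervalIntegrable (fun t => Real.exp (-μ * t)) volume 0 T :=
    (Real.continuous_exp.comp (continuous_const.mul continuous_id)).intervalIntegrable _ _
  rw [integral_eq_sub_of_hasDerivAt hderiv hint]
  have hpos : 0 < Real.exp (-μ * T) := Real.exp_pos _
  rw [mul_zero, Real.exp_zero]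
  have : -(1 / μ) * Real.exp (-μ * T) - -(1 / μ) * 1 = (1 - Real.exp (-μ * T)) / μ := by ring
  rw [this]
  exact div_le_div_of_nonneg_right (by linarith) hμ.le

/-! ### The exact mode line: every time-averaged statistic vanishes, the sup does not -/

variable {N : (T3 → E3) → ℝ} {q : ℝ}

/-- `l ≠ 0 ⇒ rate ν l = 4π²ν·|l e₂|² > 0` for `ν > 0`. [cite: Pizzocchero2021, §6 (6.3)] -/
theorem rate_pos {ν : ℝ} (hν : 0 < ν) {l : ℤ} (hl : l ≠ 0) : 0 < rate ν l := by
  have hk : modeFreq l ≠ 0 := fun h => hl (by simpa [modeFreq] using congrFun h 1)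
  have h1 : 1 ≤ freqNormSq (modeFreq l) := Torus.one_le_freqNormSq_of_ne_zero hk
  unfold rate
  have : 0 < 4 * Real.pi ^ 2 * freqNormSq (modeFreq l) := by positivity
  exact mul_pos hν this

/-- Along the line, `N(u_a(t)) = a^q N(wave_l) · e^{−(q·rate) t}` for a degree-`q` homogeneous `N`.
[cite: Pizzocchero2021, §6 (6.3), (6.7)] -/
theorem N_line_exp (hN : ∀ c : ℝ, 0 < c → ∀ w : T3 → E3, N (c • w) = c ^ q * N w)
    (ν : ℝ) (l : ℤ) {a : ℝ} (ha : 0 < a) (t : ℝ) :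
    N (line ν l a t) = a ^ q * N (wave l) * Real.exp (-(q * rate ν l) * t) := by
  rw [N_line hN ν l ha t, Real.mul_rpow (Real.exp_pos _).le ha.le, ← Real.exp_mul]
  ring_nf

/-- **The sup side**: at `t = 0` the line carries `N(u_a(0)) = a^q N(wave_l)` — any prescribed size.
[cite: Pizzocchero2021, §6 (6.7)] -/
theorem N_line_zero (hN : ∀ c : ℝ, 0 < c → ∀ w : T3 → E3, N (c • w) = c ^ q * N w)
    (ν : ℝ) (l : ℤ) {a : ℝ} (ha : 0 < a) : N (line ν l a 0) = a ^ q * N (wave l) := by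
  rw [N_line_exp hN ν l ha 0, mul_zero, Real.exp_zero, mul_one]

/-- **The Cesàro mean along the line is `O(1/T)`**: for `N ≥ 0` on the mode, `q > 0`, `ν > 0`, `l ≠ 0`,
`a > 0`, `T > 0`: `(1/T)∫₀ᵀ N(u_a(t))dt ≤ a^q N(wave_l)/(q·rate) · (1/T)`. [cite: Pizzocchero2021, §6 (6.3), (6.7)] -/
theorem cesaroMean_N_line_le (hN : ∀ c : ℝ, 0 < c → ∀ w : T3 → E3, N (c • w) = c ^ q * N w)
    (hNw : ∀ l : ℤ, 0 ≤ N (wave l)) (hq : 0 < q) {ν : ℝ} (hν : 0 < ν) {l : ℤ} (hl : l ≠ 0)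
    {a : ℝ} (ha : 0 < a) {T : ℝ} (hT : 0 < T) :
    cesaroMean (fun t => N (line ν l a t)) T ≤ a ^ q * N (wave l) / (q * rate ν l) * T⁻¹ := by
  have hμ : 0 < q * rate ν l := mul_pos hq (rate_pos hν hl)
  have hA : 0 ≤ a ^ q * N (wave l) := mul_nonneg (Real.rpow_nonneg ha.le _) (hNw l)
  unfold cesaroMean
  have hfun : (fun t => N (line ν l a t)) = fun t => a ^ q * N (wave l) * Real.exp (-(q * rate ν l) * t) :=
    funext fun t => N_line_exp hN ν l ha t
  rw [hfun, intervalIntegral.integral_const_mul, mul_comm]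
  have hI := integral_exp_neg_mul_le hμ T
  have hTi : 0 ≤ T⁻¹ := inv_nonneg.2 hT.le
  calc a ^ q * N (wave l) * (∫ t in (0 : ℝ)..T, Real.exp (-(q * rate ν l) * t)) * T⁻¹
      ≤ a ^ q * N (wave l) * (1 / (q * rate ν l)) * T⁻¹ := by gcongr
    _ = a ^ q * N (wave l) / (q * rate ν l) * T⁻¹ := by ring

/-- The Cesàro mean along the line is non-negative (`N ≥ 0` on the mode, `T > 0`). [folklore] -/
private theorem cesaroMean_N_line_nonneg (hN : ∀ c : ℝ, 0 < c → ∀ w : T3 → E3, N (c • w) = c ^ q * N w)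
    (hNw : ∀ l : ℤ, 0 ≤ N (wave l)) (ν : ℝ) (l : ℤ) {a : ℝ} (ha : 0 < a) {T : ℝ} (hT : 0 < T) :
    0 ≤ cesaroMean (fun t => N (line ν l a t)) T := by
  unfold cesaroMean
  refine mul_nonneg (inv_nonneg.2 hT.le) (intervalIntegral.integral_nonneg hT.le fun t _ => ?_)
  rw [N_line_exp hN ν l ha t]
  exact mul_nonneg (mul_nonneg (Real.rpow_nonneg ha.le _) (hNw l)) (Real.exp_pos _).le

/-- **Every time-averaged statistic of the line vanishes**: the Cesàro mean of `N(u_a(·))` tends to `0` as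
`T → ∞`, for EVERY amplitude `a > 0` (`N ≥ 0` homogeneous of degree `q > 0`, `ν > 0`, `l ≠ 0`).
[cite: Pizzocchero2021, §6 (6.3), (6.7)] -/
theorem tendsto_cesaroMean_N_line (hN : ∀ c : ℝ, 0 < c → ∀ w : T3 → E3, N (c • w) = c ^ q * N w)
    (hNw : ∀ l : ℤ, 0 ≤ N (wave l)) (hq : 0 < q) {ν : ℝ} (hν : 0 < ν) {l : ℤ} (hl : l ≠ 0)
    {a : ℝ} (ha : 0 < a) :
    Tendsto (fun T => cesaroMean (fun t => N (line ν l a t)) T) atTop (𝓝 0) := by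
  set K : ℝ := a ^ q * N (wave l) / (q * rate ν l) with hK
  have hup : Tendsto (fun T : ℝ => K * T⁻¹) atTop (𝓝 0) := by
    simpa using tendsto_const_nhds.mul tendsto_inv_atTop_zero (f := fun T : ℝ => K)
  refine tendsto_of_tendsto_of_tendsto_of_le_of_le' tendsto_const_nhds hup ?_ ?_
  · filter_upwards [eventually_gt_atTop (0 : ℝ)] with T hT
    exact cesaroMean_N_line_nonneg hN hNw ν l ha hT
  · filter_upwards [eventually_gt_atTop (0 : ℝ)] with T hT
    exact cesaroMean_N_line_le hN hNw hq hν hl ha hT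

/-! ### The no-go theorems -/

/-- **Abstract no-go.** If a statistic `Φ` takes the same value `y` on members `u` of a class `S` of
arbitrarily large size `M u`, then no function of the statistic bounds the size on `S`. [folklore] -/
private theorem no_bound_of_unbounded_family {X Y : Type*} {S : Set X} {Φ : X → Y} {M : X → ℝ} {y : Y}
    (h : ∀ B : ℝ, ∃ u ∈ S, Φ u = y ∧ B < M u) : ¬ ∃ F : Y → ℝ, ∀ u ∈ S, M u ≤ F (Φ u) := by
  rintro ⟨F, hF⟩
  obtain ⟨u, huS, hΦ, hB⟩ := h (F y)
  have := hF u huS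
  rw [hΦ] at this
  exact absurd (lt_of_lt_of_le hB this) (lt_irrefl _)

/-- Degree-2 homogeneity of `N_s = Σ|m|^{2s}|ŵ(m)|²` (same computation as `ExactModeLine`'s private
`hsSq_smul`). [cite: Pizzocchero2021, §6 (6.7)] -/
theorem hsSq_smul' (s : ℝ) {c : ℝ} (hc : 0 < c) (w : T3 → E3) :
    hsSq s (c • w) = c ^ (2 : ℝ) * hsSq s w := by
  have hfun : (⇑(EuclideanSpace.complexify (ι := Fin 3)) ∘ (c • w)) =
      (c : ℂ) • (⇑(EuclideanSpace.complexify (ι := Fin 3)) ∘ w) := by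
    funext x
    simp only [Function.comp_apply, Pi.smul_apply, LinearIsometry.map_smul, Complex.coe_smul]
  have h : ∀ m : Fin 3 → ℤ, freqNormSq m ^ s *
      ‖mFourierCoeff (EuclideanSpace.complexify ∘ (c • w)) m‖ ^ 2 =
      c ^ 2 * (freqNormSq m ^ s * ‖mFourierCoeff (EuclideanSpace.complexify ∘ w) m‖ ^ 2) := by
    intro m
    rw [hfun, mFourierCoeff_const_smul, norm_smul, Complex.norm_real, Real.norm_eq_abs,
      abs_of_pos hc]
    ring
  rw [Real.rpow_two]
  unfold hsSq
  simp_rw [h]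
  rw [tsum_mul_left]

/-- `N_s(wave_l) ≥ 0` (indeed `= (l²)^s/2`). [cite: Pizzocchero2021, §6 (6.7)] -/
theorem hsSq_wave_nonneg (s : ℝ) (l : ℤ) : 0 ≤ hsSq s (wave l) := by
  unfold hsSq
  exact tsum_nonneg fun m => mul_nonneg (Real.rpow_nonneg (freqNormSq_nonneg m) _) (sq_nonneg _)

/-- The datum of the line is mean-zero (`l ≠ 0`). [cite: Pizzocchero2021, §6 (6.6)] -/
theorem hasZeroMean_line_zero (ν : ℝ) {l : ℤ} (hl : l ≠ 0) (a : ℝ) :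
    Torus.HasZeroMean (line ν l a 0) := by
  have h : line ν l a 0 =
      realTrigPoly {modeFreq l} (fun _ => (-Complex.I) • EuclideanSpace.complexify (a • pol)) := by
    funext x
    rw [Torus.realTrigPoly_singleton_neg_I_smul_complexify]
    simp [line]
  rw [h]
  exact Torus.hasZeroMean_realTrigPoly_single 1 hl _

/-- **No-go on the mode line, any hypothesis.** Fix `s`, `ν > 0` and any predicate `P` on velocity
trajectories that holds along the whole amplitude line `u_a` (`l = 1`, all `a > 0`). Then there is NO
constant `C` with: every classical zero-mean solution on `𝕋³ × [0,∞)` satisfying `P` has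
`N_s(u(t)) ≤ C` for all `t ≥ 0` (`N_s(u_a(0)) = a²/2`). [cite: Pizzocchero2021, §6 (6.3), (6.6)–(6.7)] -/
theorem no_sup_bound_on_line_family (s : ℝ) {ν : ℝ} (P : (ℝ → T3 → E3) → Prop)
    (hP : ∀ a : ℝ, 0 < a → P (line ν 1 a)) :
    ¬ ∃ C : ℝ, ∀ (u : ℝ → T3 → E3) (p : ℝ → T3 → ℝ),
      Torus.IsClassicalNSSolutionOn (Ici 0) ν 0 u p → Torus.HasZeroMean (u 0) → P u →
      ∀ t : ℝ, 0 ≤ t → hsSq s (u t) ≤ C := by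
  rintro ⟨C, hC⟩
  set a : ℝ := 2 * |C| + 2 with ha_def
  have ha : 0 < a := by positivity
  have h := hC (line ν 1 a) (fun _ _ => 0) (isClassicalNSSolutionOn_line ν 1 a)
    (hasZeroMean_line_zero ν one_ne_zero a) (hP a ha) 0 le_rfl
  rw [N_line_zero (N := hsSq s) (q := 2) (fun _ hc w => hsSq_smul' s hc w) ν 1 ha,
    hsSq_wave s one_ne_zero] at h
  -- `h : a^2 · ((1²)^s / 2) ≤ C` with `a = 2|C| + 2`
  have h1 : ((((1 : ℤ) : ℝ)) ^ 2) ^ s = 1 := by simp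
  rw [h1, Real.rpow_two] at h
  have hC' : C ≤ |C| := le_abs_self C
  nlinarith [abs_nonneg C]

/-- **No-go, Cesàro form.** For every `s` and `ν > 0` there is NO constant `C` such that every classical
zero-mean solution on `𝕋³ × [0,∞)` whose time-averaged `N_s`-energy tends to zero
(`(1/T)∫₀ᵀ N_s(u(t))dt → 0` — satisfied by the whole mode line, and implying that every time-averaged
modal energy vanishes) obeys `N_s(u(t)) ≤ C` for all `t ≥ 0`. [cite: Pizzocchero2021, §6 (6.3), (6.6)–(6.7)] -/
theorem hsSq_no_sup_bound_from_cesaro_decay (s : ℝ) {ν : ℝ} (hν : 0 < ν) :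
    ¬ ∃ C : ℝ, ∀ (u : ℝ → T3 → E3) (p : ℝ → T3 → ℝ),
      Torus.IsClassicalNSSolutionOn (Ici 0) ν 0 u p → Torus.HasZeroMean (u 0) →
      Tendsto (fun T => cesaroMean (fun t => hsSq s (u t)) T) atTop (𝓝 0) →
      ∀ t : ℝ, 0 ≤ t → hsSq s (u t) ≤ C :=
  no_sup_bound_on_line_family s _ fun _ ha =>
    tendsto_cesaroMean_N_line (N := hsSq s) (q := 2) (fun _ hc w => hsSq_smul' s hc w)
      (hsSq_wave_nonneg s) two_pos hν one_ne_zero ha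

end CesaroSpectrum

open CesaroSpectrum ExactModeLine Literature.Analysis.FunctionSpaces

/-- **Barrier (method-level lemma): time-averaged (Cesàro) spectral statistics do not control the
sup-in-time Sobolev norms of individual Navier–Stokes solutions.** For every real `s` and every `ν > 0`:
no constant bounds `N_s(u(t)) = Σ_m|m|^{2s}|û(m,t)|²` for `t ≥ 0` over the classical zero-mean solutions on
`𝕋³ × [0,∞)` whose Cesàro means `(1/T)∫₀ᵀ N_s(u)` tend to `0`. [cite: Pizzocchero2021, §6 (6.3), (6.6)–(6.7)]

BARRIER (structured block, D-0021):
technique_class: statistical-turbulence-to-regularity time-averaged-energy-spectrum cesaro-average invariant-measure-support K41-power-law-to-sobolev-bound parseval-of-time-average ergodic-spectrum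
blocks: regularity arguments that derive `sup_{t≥0} ‖u(t)‖_{H^s} ≤ C_s` (or any pointwise-in-time bound) for individual (weak or classical) solutions from properties of the TIME-AVERAGED spectrum `Φ(k) = lim (1/T)∫₀ᵀ ½|û(k,t)|²dt` — a power law `Φ(k) ≲ k^{−5/3}`, the support / scaling invariance of a measure built from `Φ`, ensemble or ergodic averages — via «\overline{‖u‖²_{H^s}} = Σ(1+|k|²)^sΦ(k) < ∞, hence sup_t ‖u(t)‖_{H^s} < ∞» (device of record when adjudicated: C138 `LiuYong2026` Prop 4.4 p.18–19 / Lemma H.1 p.57) [cite: LiuYong2026, Prop 4.4 p.18–19; App. H Lemma H.1 p.57].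
because: on the exact Stokes-mode line `u_a(t) = a e^{−4π²νt} sin(2πx₂)e₁` every time-averaged statistic vanishes identically in the amplitude (`tendsto_cesaroMean_N_line`: `(1/T)∫₀ᵀ N(u_a) ≤ a^qN(wave)/(q·rate·T) → 0`), so `Φ ≡ 0` satisfies every power-law / support / invariance hypothesis with the SAME constants for all `a`, while `N_s(u_a(0)) = a²/2` is unbounded (`N_line_zero`): `no_bound_of_unbounded_family`, `no_sup_bound_on_line_family` (any hypothesis true along the line), `hsSq_no_sup_bound_from_cesaro_decay`. A Cesàro mean forgets the transient, and the transient is where `sup_t` lives.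
evasions_known: (a) bounds with SOLUTION-DEPENDENT constants (`C_s = C_s(u₀)`) are not excluded — but then the time average adds nothing to the initial datum; (b) statements about the time average itself (`\overline{‖u‖²_{H^s}} < ∞`) or about statistically stationary FORCED states where `sup` and mean are comparable by a separate argument (none is supplied by a spectrum alone); (c) a genuine a-priori bound of a critical/subcritical norm on the maximal interval — which is the regularity problem (`Summit.NavierStokesRegularity.StrongHypotheses.*`, positive side in the tree).
scope_caveats: (i) periodic zero-mean unforced setting `𝕋³`; with a force the line is replaced by the forced Stokes modes and the time average is the forced steady value — still independent of the transient amplitude, same conclusion (not formalised here); (ii) the kernel statements use the Fourier-side functionals `hsSq s` of `ExactModeLineDecayLaws` (`s = 0`: energy, `s = 1`: enstrophy/4π²) and the Cesàro mean of the TOTAL `N_s`-energy; modal spectra `Φ(k)` are bounded by it termwise, so every hypothesis on `Φ` weaker than «all Cesàro means vanish» inherits the no-go via `no_sup_bound_on_line_family`; (iii) nothing here bears on NS regularity, blow-up, or Kolmogorov's theory as physics — it records that a time-averaged spectrum cannot be the SOLE input of a pointwise-in-time Sobolev bound.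
status: established -/
def CesaroSpectrumNoSupControl : Prop :=
  ∀ s ν : ℝ, 0 < ν →
    ¬ ∃ C : ℝ, ∀ (u : ℝ → T3 → E3) (p : ℝ → T3 → ℝ),
      Torus.IsClassicalNSSolutionOn (Ici 0) ν 0 u p → Torus.HasZeroMean (u 0) →
      Tendsto (fun T => cesaroMean (fun t => hsSq s (u t)) T) atTop (𝓝 0) →
      ∀ t : ℝ, 0 ≤ t → hsSq s (u t) ≤ C

/-- Discharge of the barrier entry. [cite: Pizzocchero2021, §6 (6.3), (6.6)–(6.7)] -/
theorem cesaroSpectrumNoSupControl_holds : CesaroSpectrumNoSupControl :=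
  fun s _ hν => hsSq_no_sup_bound_from_cesaro_decay s hν

/-- `CesaroSpectrumNoSupControl` — `_holds` alias of `cesaroSpectrumNoSupControl_holds` above under the fact's exact name (appended
2026-08-28, D-0026 bookkeeping: the proof term is the existing theorem of this file; no statement,
definition or attribute is edited; no new named fact; the ledger's debt table listed the fact
unproved). [cite: Pizzocchero2021, §6 (6.3), (6.6)–(6.7)] -/
theorem _root_.Literature.Barriers.NavierStokesRegularity.CesaroSpectrumNoSupControl_holds :
    CesaroSpectrumNoSupControl :=
  _root_.Literature.Barriers.NavierStokesRegularity.cesaroSpectrumNoSupControl_holds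

end Literature.Barriers.NavierStokesRegularity
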